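import Summits.AtomisticToContinuum.Crystallization.Theorems.FrustratedLawDichotomyStrainedPatchHomEntryFitHcpCentredKit
import Summits.AtomisticToContinuum.Crystallization.Theorems.FrustratedLawDichotomyStrainedPatchHomCoords
import Summits.AtomisticToContinuum.Crystallization.Theorems.FrustratedLawDichotomyStrainedPatchHomEntryTable
import Summits.AtomisticToContinuum.Crystallization.Theorems.FrustratedLawDichotomyStrainedPatchHomForceCentredSound

/-!
# The directional centred hcp fit verdict `fitOKHD`: soundness, part 1 — memberships of the kit data and the first-order identity
# (27623 `(H) HomFloor (1/625)`, hcp half; critic row 1147 budget gate branch 3; sequel of `…HomEntryFitHcpCentredKit`)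

decomp-a2c hand-1 g30 (crux `AperiodicFrustratedLawGap`, stmt-AtomisticToContinuum-27623).

* §1 small interval / option facts (`pos_of_mem`, `le_hi_of_mem`, `vec3?_spec`, `elim_false_eq_true` — generic (with the tree's
  `…HomForceCentredSound.lo_lo_pos_of_divPos`, `…HomEntryTable.entries_symm`), so the kernel never
  evaluates the kit's interval data: an earlier draft that case-split on the concrete terms hit `(kernel) deep recursion`);
* §2 the centre objects (`U_c = cenMap c`, `ξ_c = cenShuf c`) and the memberships of the kit's centre data / variation data for every self-adjoint `U` of the
  entry box and every `ξ` of the shuffle box (`mem_cRc`, `mem_cDR`, …; the real identity `R_k(U,ξ) − R_k(U_c,ξ_c) = rReal (U − U_c) ξ 0 k + [s_k] U_c(ξ − ξ_c)`);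
* §3 `mem_cDR`, `mem_cRho` (the variation `ΔR_k` and its norm) and the pure-real `bracket_identity` (the first-order functional rewritten EXACTLY as
  `Σ_a D_aa C_aa + Σ_{a<b} D_ab (C_ab + C_ba) + Σ_b Δξ_b CX_b` on a symmetric offset matrix).
The pair bound (`norm_pair_le_cPairCore`, `norm_pair_le_of_cPairOK`) is the sequel `…HomEntryFitHcpCentredPair`; the verdict soundness and the leaf
integration are `…HomEntryFitHcpCentredLeaf`.

Def-free; 0 sorry; standard axioms; no instances / notation / `#eval`.  `--supports stmt-AtomisticToContinuum-27623`.
-/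

noncomputable section

namespace Summit.AtomisticToContinuum.Crystallization.Theorems.FrustratedLawDichotomyStrainedPatchHomEntryFitHcpCentred

open scoped BigOperators RealInnerProductSpace
open Literature.Analysis.ValidatedNumerics.Numerics
open Summit.AtomisticToContinuum.Crystallization.Theorems.ChargedEnergyGapNegative (E3)
open Summit.AtomisticToContinuum.Crystallization.Theorems.FrustratedLawDichotomyStrainedPatchHomSplit (latPt hexFrame hcpShift)
open Summit.AtomisticToContinuum.Crystallization.Theorems.FrustratedLawDichotomyStrainedPatchHomCoords (apply_eq_sum_entries)
open Summit.AtomisticToContinuum.Crystallization.Theorems.FrustratedLawDichotomyStrainedPatchHomLatticeBoxHcp (latPt_eq_apply_one)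
open Summit.AtomisticToContinuum.Crystallization.Theorems.FrustratedLawDichotomyStrainedPatchHomLeafCalculus (inner_eq_sum_apply)
open Summit.AtomisticToContinuum.Crystallization.Theorems.FrustratedLawDichotomyStrainedPatchHomEntryGram (entryFI mem_entryFI)
open Summit.AtomisticToContinuum.Crystallization.Theorems.FrustratedLawDichotomyStrainedPatchHomEntryGramHcp (dot3 shufFI mem_dot3 mem_shufFI)
open Summit.AtomisticToContinuum.Crystallization.Theorems.FrustratedLawDichotomyStrainedPatchHomEntryFit (scaleL devFI mem_devFI)
open Summit.AtomisticToContinuum.Crystallization.Theorems.FrustratedLawDichotomyStrainedPatchHomEntryHcpFrame (hlab hshift nbr nbrU norm_nbr)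
open Summit.AtomisticToContinuum.Crystallization.Theorems.FrustratedLawDichotomyStrainedPatchHomEntryFitHcpSharpKit
  (nbrFI rVec rReal rP rSq nrm2 dlt devH mem_nbrFI mem_rVec nbrU_eq_smul_add_rReal)
open Summit.AtomisticToContinuum.Crystallization.Theorems.FrustratedLawDichotomyStrainedPatchHomCurvCentreKit
  (zW cenMap cenShuf cenMap_apply cenMap_entry cenMap_box cenShuf_apply cenShuf_box)
open Summit.AtomisticToContinuum.Crystallization.Theorems.FrustratedLawDichotomyStrainedPatchHomEntryFitCentredReal (pairResidual_le)
open Summit.AtomisticToContinuum.Crystallization.Theorems.FrustratedLawDichotomyStrainedPatchHomEntryTable (entries_symm)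
open Summit.AtomisticToContinuum.Crystallization.Theorems.FrustratedLawDichotomyStrainedPatchHomForceCentredSound (lo_pos_of_divPos)

/-! ## §1. Small interval facts -/

/-- A member of a certainly-positive interval is positive. [formal bookkeeping] -/
theorem pos_of_mem {x : ℝ} {J : FI} (hx : FI.mem x J) (hJ : 0 < J.lo) : 0 < x := by
  have h1 := (FI.mem_def.1 hx).1
  have hS : (0 : ℝ) < SC := by norm_num [SC]
  have : (0 : ℝ) < (J.lo : ℝ) := by exact_mod_cast hJ
  nlinarith

/-- Upper end of a membership. [formal bookkeeping] -/
theorem le_hi_of_mem {x : ℝ} {I : FI} (hx : FI.mem x I) : x * SC ≤ (I.hi : ℝ) := (FI.mem_def.1 hx).2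

/-- `vec3?` returns the three values. [formal bookkeeping] -/
theorem vec3?_spec {f : Fin 3 → Option FI} {e : Fin 3 → FI} (h : vec3? f = some e) (a : Fin 3) : f a = some (e a) := by
  unfold vec3? at h
  obtain ⟨x, hx, h⟩ := Option.bind_eq_some_iff.1 h
  obtain ⟨y, hy, h⟩ := Option.bind_eq_some_iff.1 h
  obtain ⟨z, hz, h⟩ := Option.bind_eq_some_iff.1 h
  simp only [Option.some.injEq] at h
  subst h
  fin_cases a
  · simpa using hx
  · simpa using hy
  · simpa using hz

/-- Generic: a passed `Option.elim false p` test exhibits its witness. [formal bookkeeping] -/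
theorem elim_false_eq_true {α : Type*} {o : Option α} {p : α → Bool} (h : o.elim false p = true) : ∃ a, o = some a ∧ p a = true := by
  cases o with
  | none => simp at h
  | some a => exact ⟨a, rfl, h⟩

/-! ## §2. Centre objects and memberships -/

/-- `rReal D ξ 0 k = D (n_k + [s_k] ξ)`. [formal bookkeeping] -/
theorem rReal_zero_eq (D : E3 →L[ℝ] E3) (ξ : E3) (k : Fin 12) :
    rReal D ξ 0 k = D (nbr k + (if hshift k then ξ else 0)) := by
  unfold rReal nbr
  rw [latPt_eq_apply_one]
  have e : latPt 1 hexFrame (hlab k) = ∑ i : Fin 3, ((hlab k i : ℤ) : ℝ) • hexFrame i := by simp [latPt]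
  rw [e]
  cases hshift k <;> simp [map_add, zero_smul, add_assoc]

/-- ★ The variation identity: with `V = U − λ·1`, `V_c = U_c − λ·1`,
`rReal V ξ λ k − rReal V_c ξ_c λ k = rReal (U − U_c) ξ 0 k + [s_k] U_c (ξ − ξ_c)`. [algebra] -/
theorem rReal_sub_rReal (U Uc : E3 →L[ℝ] E3) (ξ ξc : E3) (lam : ℝ) (k : Fin 12) :
    rReal (U - lam • (1 : E3 →L[ℝ] E3)) ξ lam k - rReal (Uc - lam • (1 : E3 →L[ℝ] E3)) ξc lam k =
      rReal (U - Uc) ξ 0 k + (if hshift k then Uc (ξ - ξc) else 0) := by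
  rw [rReal_zero_eq]
  unfold rReal
  rw [latPt_eq_apply_one (U - lam • (1 : E3 →L[ℝ] E3)), latPt_eq_apply_one (Uc - lam • (1 : E3 →L[ℝ] E3))]
  set P : E3 := latPt 1 hexFrame (hlab k) with hP
  have enbr : nbr k = P + (if hshift k then hcpShift else 0) := by simp [nbr, hP, latPt]
  have h1 : ∀ x : E3, (U - lam • (1 : E3 →L[ℝ] E3)) x = U x - lam • x := fun x => by simp
  have h2 : ∀ x : E3, (Uc - lam • (1 : E3 →L[ℝ] E3)) x = Uc x - lam • x := fun x => by simp
  have h3 : ∀ x : E3, (U - Uc) x = U x - Uc x := fun x => by simp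
  rw [enbr]
  cases hshift k
  · simp only [Bool.false_eq_true, ↓reduceIte, add_zero, h1, h2, h3]
    abel
  · simp only [↓reduceIte, map_add, map_sub, h1, h2, h3, smul_add]
    abel

variable {c w : (Fin 3 × Fin 3) ⊕ Fin 3 → ℤ}

/-- The entry offsets `D_ab = U_ab − c_ab/SC` lie in `wdFI`. [formal bookkeeping] -/
theorem mem_wdFI (U : E3 →L[ℝ] E3)
    (hbox : ∀ ab : Fin 3 × Fin 3, |(U (EuclideanSpace.single ab.2 (1 : ℝ))) ab.1 - (c (Sum.inl ab) : ℝ) / SC| ≤ (w (Sum.inl ab) : ℝ) / SC)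
    (ab : Fin 3 × Fin 3) : FI.mem (((U - cenMap c) (EuclideanSpace.single ab.2 (1 : ℝ))) ab.1) (wdFI w ab) := by
  have hS : (0 : ℝ) < SC := by norm_num [SC]
  have e : ((U - cenMap c) (EuclideanSpace.single ab.2 (1 : ℝ))) ab.1 = (U (EuclideanSpace.single ab.2 (1 : ℝ))) ab.1 - (c (Sum.inl ab) : ℝ) / SC := by
    rw [← cenMap_entry c ab.1 ab.2]; simp
  rw [e]
  have h := hbox ab
  rw [abs_le] at h
  obtain ⟨h1, h2⟩ := h
  refine FI.mem_def.2 ⟨?_, ?_⟩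
  · show ((-w (Sum.inl ab) : ℤ) : ℝ) ≤ _
    push_cast
    have := mul_le_mul_of_nonneg_right h1 hS.le
    rwa [neg_mul, div_mul_cancel₀ _ hS.ne'] at this
  · show _ ≤ ((w (Sum.inl ab) : ℤ) : ℝ)
    have := mul_le_mul_of_nonneg_right h2 hS.le
    rwa [div_mul_cancel₀ _ hS.ne'] at this

/-- The shuffle offsets `ξ_b − ξ_{c,b}` lie in `wxFI`. [formal bookkeeping] -/
theorem mem_wxFI {ξ : E3} (hξb : ∀ i : Fin 3, |ξ i - (c (Sum.inr i) : ℝ) / SC| ≤ (w (Sum.inr i) : ℝ) / SC) (b : Fin 3) :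
    FI.mem ((ξ - cenShuf c) b) (wxFI w b) := by
  have hS : (0 : ℝ) < SC := by norm_num [SC]
  rw [PiLp.sub_apply, cenShuf_apply]
  have h := hξb b
  rw [abs_le] at h
  obtain ⟨h1, h2⟩ := h
  refine FI.mem_def.2 ⟨?_, ?_⟩
  · show ((-w (Sum.inr b) : ℤ) : ℝ) ≤ _
    push_cast
    have := mul_le_mul_of_nonneg_right h1 hS.le
    rwa [neg_mul, div_mul_cancel₀ _ hS.ne'] at this
  · show _ ≤ ((w (Sum.inr b) : ℤ) : ℝ)
    have := mul_le_mul_of_nonneg_right h2 hS.le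
    rwa [div_mul_cancel₀ _ hS.ne'] at this

/-- `(U_c y)_a` lies in `cUdx` when `y_b ∈ wxFI`. [formal bookkeeping] -/
theorem mem_cUdx {y : E3} (hy : ∀ b, FI.mem (y b) (wxFI w b)) (a : Fin 3) : FI.mem ((cenMap c y) a) (cUdx c w a) := by
  rw [cenMap_apply, Fin.sum_univ_three]
  exact FI.mem_add (FI.mem_add (FI.mem_mul (FI.mem_ofScaled _) (hy 0)) (FI.mem_mul (FI.mem_ofScaled _) (hy 1)))
    (FI.mem_mul (FI.mem_ofScaled _) (hy 2))

/-- `m_k(ξ)_b` lies in `cM`. [formal bookkeeping] -/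
theorem mem_cM {ξ : E3} (hX : ∀ i, FI.mem (ξ i) (shufFI c w i)) (k : Fin 12) (b : Fin 3) :
    FI.mem ((nbr k + (if hshift k then ξ else 0)) b) (cM c w k b) := by
  unfold cM
  rw [PiLp.add_apply]
  refine FI.mem_add (mem_nbrFI k b) ?_
  cases hshift k
  · simpa using FI.mem_ofInt 0
  · simpa using hX b

/-! ## §3. The pair bound -/

/-- Components of `R_k − R_k(c)` lie in `cDR`. [formal bookkeeping] -/
theorem mem_cDR (U : E3 →L[ℝ] E3) (ξ : E3) (lam : ℝ)
    (hbox : ∀ ab : Fin 3 × Fin 3, |(U (EuclideanSpace.single ab.2 (1 : ℝ))) ab.1 - (c (Sum.inl ab) : ℝ) / SC| ≤ (w (Sum.inl ab) : ℝ) / SC)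
    (hξb : ∀ i : Fin 3, |ξ i - (c (Sum.inr i) : ℝ) / SC| ≤ (w (Sum.inr i) : ℝ) / SC) (k : Fin 12) (a : Fin 3) :
    FI.mem ((rReal (U - lam • (1 : E3 →L[ℝ] E3)) ξ lam k - rReal (cenMap c - lam • (1 : E3 →L[ℝ] E3)) (cenShuf c) lam k) a) (cDR c w k a) := by
  have hX : ∀ i, FI.mem (ξ i) (shufFI c w i) := fun i => mem_shufFI (hξb i)
  rw [rReal_sub_rReal, rReal_zero_eq, PiLp.add_apply, apply_eq_sum_entries]
  unfold cDR
  refine FI.mem_add (mem_sum3 fun b => FI.mem_mul (mem_wdFI U hbox (a, b)) (mem_cM hX k b)) ?_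
  cases hshift k
  · simpa using FI.mem_ofInt 0
  · simpa using mem_cUdx (fun b => mem_wxFI hξb b) a

/-- `‖R_k − R_k(c)‖` lies in `cRho`. [formal bookkeeping] -/
theorem mem_cRho (U : E3 →L[ℝ] E3) (ξ : E3) (lam : ℝ)
    (hbox : ∀ ab : Fin 3 × Fin 3, |(U (EuclideanSpace.single ab.2 (1 : ℝ))) ab.1 - (c (Sum.inl ab) : ℝ) / SC| ≤ (w (Sum.inl ab) : ℝ) / SC)
    (hξb : ∀ i : Fin 3, |ξ i - (c (Sum.inr i) : ℝ) / SC| ≤ (w (Sum.inr i) : ℝ) / SC) (k : Fin 12) :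
    FI.mem ‖rReal (U - lam • (1 : E3 →L[ℝ] E3)) ξ lam k - rReal (cenMap c - lam • (1 : E3 →L[ℝ] E3)) (cenShuf c) lam k‖ (cRho c w k) := by
  set v := rReal (U - lam • (1 : E3 →L[ℝ] E3)) ξ lam k - rReal (cenMap c - lam • (1 : E3 →L[ℝ] E3)) (cenShuf c) lam k
  have h2 : FI.mem (‖v‖ ^ 2) (dot3 (cDR c w k) (cDR c w k)) := by
    rw [← real_inner_self_eq_norm_sq]
    exact mem_dot3 (mem_cDR U ξ lam hbox hξb k) (mem_cDR U ξ lam hbox hξb k)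
  have := FI.mem_sqrt h2
  rwa [Real.sqrt_sq (norm_nonneg _)] at this

/-- The pure-real rearrangement of the first-order functional on a symmetric offset matrix. [algebra] -/
theorem bracket_identity (e g Mk Mk' y : Fin 3 → ℝ) (d u : Fin 3 → Fin 3 → ℝ) (en : ℝ) (sk sk' : Bool)
    (h10 : d 1 0 = d 0 1) (h20 : d 2 0 = d 0 2) (h21 : d 2 1 = d 1 2) :
    (∑ a : Fin 3, e a * (∑ b : Fin 3, d a b * Mk b + (if sk then ∑ b : Fin 3, u a b * y b else 0))) -
        en * (∑ a : Fin 3, g a * (∑ b : Fin 3, d a b * Mk' b + (if sk' then ∑ b : Fin 3, u a b * y b else 0))) =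
      ((((∑ a : Fin 3, d a a * (e a * Mk a - en * g a * Mk' a)) +
          d 0 1 * ((e 0 * Mk 1 - en * g 0 * Mk' 1) + (e 1 * Mk 0 - en * g 1 * Mk' 0))) +
            d 0 2 * ((e 0 * Mk 2 - en * g 0 * Mk' 2) + (e 2 * Mk 0 - en * g 2 * Mk' 0))) +
            d 1 2 * ((e 1 * Mk 2 - en * g 1 * Mk' 2) + (e 2 * Mk 1 - en * g 2 * Mk' 1))) +
        ∑ b : Fin 3, y b * ((if sk then ∑ a : Fin 3, u a b * e a else 0) - en * (if sk' then ∑ a : Fin 3, u a b * g a else 0)) := by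
  simp only [Fin.sum_univ_three]
  cases sk <;> cases sk' <;> simp only [Bool.false_eq_true, ↓reduceIte, add_zero, zero_sub, sub_zero, mul_zero] <;>
    rw [h10, h20, h21] <;> ring

end Summit.AtomisticToContinuum.Crystallization.Theorems.FrustratedLawDichotomyStrainedPatchHomEntryFitHcpCentred

end
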